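import Mathlib
import Literature.NumberTheory.Transcendental.DrinfeldAssociatorMonodromy
import Literature.NumberTheory.Transcendental.DrinfeldAssociatorLimit
import HarnessLib

/-!
# The KZ monodromy contour for the hexagon equations: the loop identity [Drinfeld1991, §2]

Second proofs file towards the hexagon half of `drinfeldAssociator_isAssociatorPair`
(`DrinfeldAssociator.lean`), continuing `DrinfeldAssociatorMonodromy.lean`. We formalise the
geometric part of Drinfeld's proof [Drinfeld1991, §2] that `Φ_KZ` satisfies the hexagon
relations with `μ = ±2πi` "by using symmetry of the KZ-system" [Furusho2011, §1]: the
triviality of the monodromy of `G'(z) = (A/z + B/(z-1)) G(z)` around a contour in the closed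
upper half plane passing above `0`, `1`, `∞`, organised by the `ℤ/3`-symmetry `ρ(z) = 1/(1-z)`.

1. The KZ densities `fKZ` on `ℂ ∖ {0,1}`, the rotation `ρ` (`0 ↦ 1 ↦ ∞ ↦ 0`, `ρ³ = id`) and
   **the pull-back formula** `ρ^*(A dz/z + B dz/(z-1)) = B dz/z + (-A-B) dz/(z-1)` (`fKZ_rho`),
   encoded by the letter matrix `mrho` (`σ̂ = NCSeries.push mrho : A ↦ B, B ↦ -A-B`).
2. The convex domains `D₀` (the disc centred at `1/2 + i` through `0` and `1`),
   `D₁ = ρ(D₀) = {x + 2y > 1}`, `D₂ = ρ²(D₀) = {x < 2y}` and the hub `ℍ`: membership in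
   coordinates, `ρ(D₀) ⊆ D₁`, `ρ(D₁) ⊆ D₂`, `ρ(D₂) ⊆ D₀`, `ρ(ℍ) ⊆ ℍ`, and the data needed for
   holomorphic fundamental solutions on them (open, convex, primitives, `0, 1 ∉`).
3. `C¹` paths in `ℂ ∖ {0,1}` (`KZPath`), their transports `KZPath.T` (complex iterated
   integrals), the local path formula (`KZPath.kzFund_eq_T`), the image path `ρ ∘ γ` and
   **functoriality** `T(ρ ∘ γ) = σ̂(T(γ))` (`KZPath.T_rhoPath`); the real-axis path (whose
   transport is the real KZ transport `KZ3.kzTransport`, `seg_eq_map_kzTransport`) and the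
   half-circle `1 + ε e^{i(π-t)}` around `1`, along which the `B`-density is the constant `-i`
   (`circPath_dens_true`) and the `A`-density is `O(ε)` (`norm_circPath_dens_false_le`).
4. **The loop identity** (`loop_identity`, `loop_identity_cap`): for `0 < ε < 1/2`, with
   `seg = T([ε, 1-ε])` and `cap` = transport along the half-circle followed by
   `[1+ε, ρ(ε) = 1 + ε/(1-ε)]`,
   `σ̂²(cap) σ̂²(seg) σ̂(cap) σ̂(seg) cap seg = 1`
   — the contour `P₁ P₂ ρ(P₁) ρ(P₂) ρ²(P₁) ρ²(P₂)` closes up at `ρ³(ε) = ε`, and its total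
   transport is computed through the fundamental solutions on `D₀, D₁, D₂, ℍ` (Chen's rule
   inside each domain, agreement on the convex overlaps at the junctions `1+iε`, `i/ε`,
   `ρ(i/ε)`).

The limit `ε → 0⁺` (factorisation `seg = e^{-LB} Φ_ε e^{LA}` of `DrinfeldAssociatorEdge.lean`,
`cap → e^{-iπB}`) giving the 3-cycle relation [Drinfeld1991, (5.3)] with `μ = -2πi`, and the
hexagons, follow in the next file. Everything is proved; no named fact is introduced.

## References

* V. G. Drinfel'd, *On quasitriangular quasi-Hopf algebras and on a group that is closely
  connected with Gal(Q̄/Q)*, Leningrad Math. J. 2 (1991), 829–860, §2, (2.12), §5, (5.3).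
  [Drinfeld1991]
* H. Furusho, *Double shuffle relation for associators*, Ann. of Math. 174 (2011), §1 (p. 3 of
  arXiv:0808.0319: "It is shown in [Dr] that Φ_KZ satisfies GT-relations (with μ = 2πi) by
  using symmetry of the KZ-system on configuration spaces"). [Furusho2011]
* H. Furusho, Publ. RIMS 39 (2003), §3.1–3.2 (the KZ equation, `Φ_KZ`). [Furusho2003]
-/

noncomputable section

open MeasureTheory intervalIntegral Set Filter Metric Complex
open scoped BigOperators Topology Real

namespace Literature.NumberTheory.Transcendental

/-! ## 0. Two complements to the monodromy toolkit -/

universe u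

/-- Iterated integrals only depend on the densities on the parameter interval. [folklore] -/
theorem citerInt_congr {α : Type u} {g g' : α → ℝ → ℂ} {a b : ℝ}
    (h : ∀ c, ∀ t ∈ uIcc a b, g c t = g' c t) :
    ∀ (w : List α) {b' : ℝ}, b' ∈ uIcc a b → citerInt g w a b' = citerInt g' w a b'
  | [], _, _ => rfl
  | c :: w, b', hb' => by
    rw [citerInt_cons, citerInt_cons]
    refine intervalIntegral.integral_congr fun t ht => ?_
    have ht' : t ∈ uIcc a b := uIcc_subset_uIcc_left hb' ht
    rw [h c t ht', citerInt_congr h w ht']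

/-- **Local path formula.** As `IsKZSol.path`, but for a path which is `C¹` only on an open set
`s ⊇ [a,b]` of parameters (e.g. `t ↦ 1/(1-t)` on `(0,1)`). [folklore] -/
theorem IsKZSol.pathOn {α : Type u} {f : α → ℂ → ℂ} {U : Set ℂ} (hUo : IsOpen U)
    (hfc : ∀ c, ContinuousOn (f c) U) {Y : ℂ → NCSeries α ℂ} (hY : IsKZSol f U Y)
    {s : Set ℝ} (hs : IsOpen s) {γ γ' : ℝ → ℂ} (hγ : ∀ t ∈ s, HasDerivAt γ (γ' t) t)
    (hγ' : ContinuousOn γ' s) {a b : ℝ} (hab : a ≤ b) (hIcc : Icc a b ⊆ s)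
    (hmaps : MapsTo γ (Icc a b) U) (h0 : Y (γ a) = 1) :
    Y (γ b) = ctransport (fun c t => f c (γ t) * γ' t) a b := by
  have hγc : ContinuousOn γ s := fun t ht => (hγ t ht).continuousAt.continuousWithinAt
  have hSo : IsOpen (s ∩ γ ⁻¹' U) := hγc.isOpen_inter_preimage hs hUo
  obtain ⟨a', b', ha', hb', hsub⟩ :=
    exists_Ioo_subset_of_Icc_subset hSo hab (fun t ht => ⟨hIcc ht, hmaps ht⟩)
  set s' : Set ℝ := Ioo a' b' with hs'_def
  have hs' : IsOpen s' := isOpen_Ioo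
  have hso' : s'.OrdConnected := ordConnected_Ioo
  have has' : a ∈ s' := ⟨ha', lt_of_le_of_lt hab hb'⟩
  set g : α → ℝ → ℂ := fun c t => f c (γ t) * γ' t with hg_def
  have hg : ∀ c, ContinuousOn (g c) s' := by
    intro c t ht
    have hts : t ∈ s := (hsub ht).1
    have hγt : γ t ∈ U := (hsub ht).2
    exact (((hfc c).continuousAt (hUo.mem_nhds hγt)).comp_continuousWithinAt
      ((hγc t hts).mono_of_mem_nhdsWithin (mem_nhdsWithin_of_mem_nhds (hs.mem_nhds hts)))).mul
      ((hγ' t hts).mono_of_mem_nhdsWithin (mem_nhdsWithin_of_mem_nhds (hs.mem_nhds hts)))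
  suffices key : ∀ w : List α, ∀ t ∈ Icc a b, Y (γ t) w = citerInt g w a t by
    funext w; exact key w b (right_mem_Icc.mpr hab)
  intro w
  induction w with
  | nil =>
    intro t ht
    have hD : ∀ x ∈ Icc a b, Y (γ x) [] = Y (γ a) [] := by
      refine constant_of_has_deriv_right_zero (f := fun x => Y (γ x) []) ?_ ?_
      · intro x hx
        exact (((hY.1 (γ x) (hmaps hx)).comp x (hγ x (hIcc hx))).continuousAt).continuousWithinAt
      · intro x hx
        have h := (hY.1 (γ x) (hmaps (Ico_subset_Icc_self hx))).comp x
          (hγ x (hIcc (Ico_subset_Icc_self hx)))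
        rw [zero_mul] at h
        exact h.hasDerivWithinAt
    rw [hD t ht, h0]; rfl
  | cons c w ih =>
    intro t ht
    have hderiv : ∀ x ∈ s', HasDerivAt (fun x => Y (γ x) (c :: w) - citerInt g (c :: w) a x)
        (f c (γ x) * Y (γ x) w * γ' x - g c x * citerInt g w a x) x := fun x hx =>
      ((hY.2 c w (γ x) (hsub hx).2).comp x (hγ x (hsub hx).1)).sub
        (hasDerivAt_citerInt_cons hs' hso' hg has' c w hx)
    have hD : ∀ x ∈ Icc a b, Y (γ x) (c :: w) - citerInt g (c :: w) a x =
        Y (γ a) (c :: w) - citerInt g (c :: w) a a := by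
      refine constant_of_has_deriv_right_zero ?_ ?_
      · intro x hx
        have hxs : x ∈ s' := ⟨by linarith [hx.1], by linarith [hx.2]⟩
        exact (hderiv x hxs).continuousAt.continuousWithinAt
      · intro x hx
        have hxs : x ∈ s' := ⟨by linarith [hx.1], by linarith [hx.2]⟩
        have h := hderiv x hxs
        rw [ih x (Ico_subset_Icc_self hx), hg_def] at h
        simp only at h
        rw [show f c (γ x) * citerInt (fun c t => f c (γ t) * γ' t) w a x * γ' x -
            f c (γ x) * γ' x * citerInt (fun c t => f c (γ t) * γ' t) w a x = 0 by ring] at h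
        exact h.hasDerivWithinAt
    have h := hD t ht
    rw [h0, citerInt_self_of_ne_nil g (List.cons_ne_nil c w), NCSeries.one_apply_cons, sub_zero,
      sub_eq_zero] at h
    exact h

namespace KZHex

/-! ## 1. The KZ densities on `ℂ ∖ {0, 1}` and the rotation `ρ(z) = 1/(1-z)` -/

/-- The letter densities of the KZ connection `ω = A dz/z + B dz/(z-1)` on `ℂ ∖ {0,1}`
(`A = X₀ = false`, `B = X₁ = true`). [cite: Furusho2003, §3.1] -/
def fKZ (c : Bool) (z : ℂ) : ℂ := if c then (z - 1)⁻¹ else z⁻¹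

/-- `f_A(z) = 1/z`. [folklore] -/
@[simp] theorem fKZ_false (z : ℂ) : fKZ false z = z⁻¹ := rfl

/-- `f_B(z) = 1/(z-1)`. [folklore] -/
@[simp] theorem fKZ_true (z : ℂ) : fKZ true z = (z - 1)⁻¹ := rfl

/-- The KZ densities are holomorphic away from `0` and `1`. [folklore] -/
theorem differentiableAt_fKZ (c : Bool) {z : ℂ} (h0 : z ≠ 0) (h1 : z ≠ 1) :
    DifferentiableAt ℂ (fKZ c) z := by
  cases c
  · exact (hasDerivAt_inv h0).differentiableAt
  · exact (((hasDerivAt_id z).sub_const 1).inv (sub_ne_zero.mpr h1)).differentiableAt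

/-- The KZ densities are holomorphic on any set avoiding `0` and `1`. [folklore] -/
theorem differentiableOn_fKZ {U : Set ℂ} (h0 : (0 : ℂ) ∉ U) (h1 : (1 : ℂ) ∉ U) (c : Bool) :
    DifferentiableOn ℂ (fKZ c) U := fun _ hz =>
  (differentiableAt_fKZ c (ne_of_mem_of_not_mem hz h0) (ne_of_mem_of_not_mem hz h1)).differentiableWithinAt

/-- On the real axis the complex KZ densities are the real ones of `DrinfeldAssociatorLimit.lean`
(`KZ3.F₀ A = 1/t`, `KZ3.F₀ B = 1/(t-1)`). [folklore] -/
theorem fKZ_ofReal (c : Bool) (t : ℝ) : fKZ c (t : ℂ) = ((KZ3.F₀ c t : ℝ) : ℂ) := by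
  cases c
  · rw [fKZ_false, KZ3.F₀_false, one_div, Complex.ofReal_inv]
  · rw [fKZ_true, KZ3.F₀_true, one_div, Complex.ofReal_inv, Complex.ofReal_sub, Complex.ofReal_one]

/-- **The rotation** `ρ(z) = 1/(1-z)` of `ℙ¹ ∖ {0, 1, ∞}` (`0 ↦ 1 ↦ ∞ ↦ 0`).
[cite: Drinfeld1991, §2] -/
def rho (z : ℂ) : ℂ := (1 - z)⁻¹

/-- `ρ'(z) = 1/(1-z)²`. [folklore] -/
theorem hasDerivAt_rho {z : ℂ} (hz : z ≠ 1) : HasDerivAt rho ((1 - z) ^ 2)⁻¹ z := by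
  have h : HasDerivAt (fun z : ℂ => 1 - z) (-1) z := by
    simpa using (hasDerivAt_id z).const_sub (1 : ℂ)
  have h1 : (1 : ℂ) - z ≠ 0 := sub_ne_zero.mpr (Ne.symm hz)
  have h' := h.inv h1
  rw [neg_neg, one_div] at h'
  exact h'

/-- `ρ(z) ≠ 0` for `z ≠ 1`. [folklore] -/
theorem rho_ne_zero {z : ℂ} (hz : z ≠ 1) : rho z ≠ 0 :=
  inv_ne_zero (sub_ne_zero.mpr (Ne.symm hz))

/-- `ρ(z) ≠ 1` for `z ≠ 0`. [folklore] -/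
theorem rho_ne_one {z : ℂ} (hz : z ≠ 0) : rho z ≠ 1 := by
  intro h
  apply hz
  have h1 : (1 : ℂ) - z ≠ 0 := by
    intro h0; rw [rho, h0, inv_zero] at h; exact zero_ne_one h
  have := congrArg (fun w => w * (1 - z)) h
  simp only [rho, inv_mul_cancel₀ h1, one_mul] at this
  linear_combination this

/-- `ρ²(z) = 1 - 1/z`. [folklore] -/
theorem rho_rho {z : ℂ} (h0 : z ≠ 0) (h1 : z ≠ 1) : rho (rho z) = 1 - z⁻¹ := by
  have h1' : (1 : ℂ) - z ≠ 0 := sub_ne_zero.mpr (Ne.symm h1)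
  have key : (1 : ℂ) - (1 - z)⁻¹ = -z * (1 - z)⁻¹ := by
    calc (1 : ℂ) - (1 - z)⁻¹ = (1 - z)⁻¹ * (1 - z) - (1 - z)⁻¹ := by rw [inv_mul_cancel₀ h1']
      _ = -z * (1 - z)⁻¹ := by ring
  unfold rho
  rw [key, mul_inv, inv_inv, inv_neg, neg_mul, mul_sub, mul_one, inv_mul_cancel₀ h0]
  ring

/-- **`ρ` has order three**: `ρ(ρ(ρ(z))) = z` on `ℂ ∖ {0,1}`. [folklore] -/
theorem rho_rho_rho {z : ℂ} (h0 : z ≠ 0) (h1 : z ≠ 1) : rho (rho (rho z)) = z := by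
  rw [show rho (rho (rho z)) = (1 - rho (rho z))⁻¹ from rfl, rho_rho h0 h1, sub_sub_cancel, inv_inv]

/-- Real and imaginary parts of `ρ(z)`: `ρ(z) = (1 - x + iy)/M`, `M = (1-x)² + y²`. [folklore] -/
theorem rho_re_im (z : ℂ) :
    (rho z).re = (1 - z.re) / ((1 - z.re) ^ 2 + z.im ^ 2) ∧
      (rho z).im = z.im / ((1 - z.re) ^ 2 + z.im ^ 2) := by
  have hn : Complex.normSq (1 - z) = (1 - z.re) ^ 2 + z.im ^ 2 := by
    rw [Complex.normSq_apply]; simp; ring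
  refine ⟨?_, ?_⟩
  · rw [rho, Complex.inv_re, hn]; simp
  · rw [rho, Complex.inv_im, hn]; simp

/-- The letter matrix of the substitution `σ̂ : A ↦ B, B ↦ -A - B` induced by `ρ`
(`NCSeries.push mrho`: the source letter `b` goes to `Σ_c mrho b c · c`).
[cite: Drinfeld1991, §2] -/
def mrho : Bool → Bool → ℂ
  | false, false => 0
  | false, true => 1
  | true, _ => -1

/-- **The pull-back of the KZ form under `ρ`**: `ρ^*(f_c dz) = Σ_b mrho(b,c) f_b dz`, i.e.
`f_A(ρ z) ρ'(z) = -f_B(z)` and `f_B(ρ z) ρ'(z) = f_A(z) - f_B(z)`. [cite: Drinfeld1991, §2] -/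
theorem fKZ_rho (c : Bool) {z : ℂ} (h0 : z ≠ 0) (h1 : z ≠ 1) :
    fKZ c (rho z) * ((1 - z) ^ 2)⁻¹ = ∑ b, mrho b c * fKZ b z := by
  have h1' : (1 : ℂ) - z ≠ 0 := sub_ne_zero.mpr (Ne.symm h1)
  have hneg : -(z - 1)⁻¹ = (1 - z)⁻¹ := by rw [← inv_neg, neg_sub]
  rw [Fintype.sum_bool]
  cases c
  · simp only [fKZ_false, fKZ_true, mrho, rho, zero_mul, add_zero, neg_one_mul, inv_inv]
    rw [hneg, pow_two, mul_inv, ← mul_assoc, mul_inv_cancel₀ h1', one_mul]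
  · simp only [fKZ_false, fKZ_true, mrho, rho, one_mul, neg_one_mul]
    have key : (1 - z)⁻¹ - 1 = z * (1 - z)⁻¹ := by
      calc (1 - z)⁻¹ - 1 = (1 - z)⁻¹ - (1 - z)⁻¹ * (1 - z) := by rw [inv_mul_cancel₀ h1']
        _ = z * (1 - z)⁻¹ := by ring
    rw [key, mul_inv, inv_inv, pow_two, mul_inv,
      show z⁻¹ * (1 - z) * ((1 - z)⁻¹ * (1 - z)⁻¹) = z⁻¹ * (1 - z)⁻¹ * ((1 - z) * (1 - z)⁻¹) by ring,
      mul_inv_cancel₀ h1', mul_one, hneg]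
    field_simp
    ring

/-! ## 2. The three convex domains `D₀`, `D₁ = ρ(D₀)`, `D₂ = ρ²(D₀)` and the hub `ℍ` -/

/-- `D₀`: the open disc centred at `1/2 + i` of radius `√5/2`, whose boundary circle passes
through `0` and `1`; it contains the real interval `(0,1)` and bulges into the upper half plane
above `0` and `1`. [folklore] -/
def D0 : Set ℂ := ball ⟨1 / 2, 1⟩ (Real.sqrt 5 / 2)

/-- `D₁ = ρ(D₀)`: the open half-plane `{x + 2y > 1}` (boundary line through `1 = ρ(0)`).
[folklore] -/
def D1 : Set ℂ := halfPlane 1 (1 + 2 * I)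

/-- `D₂ = ρ²(D₀)`: the open half-plane `{x < 2y}` (boundary line through `0 = ρ²(1)`).
[folklore] -/
def D2 : Set ℂ := halfPlane 0 (-1 + 2 * I)

/-- The hub: the open upper half-plane `ℍ = {y > 0}`. [folklore] -/
def Dtop : Set ℂ := halfPlane 0 I

/-- Membership in `D₀` in coordinates: `y(y-2) < x(1-x)`. [folklore] -/
theorem mem_D0 {z : ℂ} : z ∈ D0 ↔ z.im * (z.im - 2) < z.re * (1 - z.re) := by
  have hs : Real.sqrt 5 / 2 = Real.sqrt (5 / 2 ^ 2) := by
    rw [Real.sqrt_div' 5 (by norm_num : (0 : ℝ) ≤ 2 ^ 2), Real.sqrt_sq (by norm_num : (0 : ℝ) ≤ 2)]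
  rw [D0, mem_ball, Complex.dist_eq, hs, Real.lt_sqrt (norm_nonneg _), ← Complex.normSq_eq_norm_sq,
    Complex.normSq_apply]
  simp only [Complex.sub_re, Complex.sub_im]
  constructor
  · intro h; nlinarith
  · intro h; nlinarith

/-- Membership in `D₁` in coordinates: `(x - 1) + 2y > 0`. [folklore] -/
theorem mem_D1 {z : ℂ} : z ∈ D1 ↔ 0 < (z.re - 1) + 2 * z.im := by
  rw [D1, mem_halfPlane, conj_mul_re]
  simp

/-- Membership in `D₂` in coordinates: `-x + 2y > 0`. [folklore] -/
theorem mem_D2 {z : ℂ} : z ∈ D2 ↔ 0 < -z.re + 2 * z.im := by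
  rw [D2, mem_halfPlane, conj_mul_re]
  simp [neg_mul]

/-- Membership in `ℍ` in coordinates: `y > 0`. [folklore] -/
theorem mem_Dtop {z : ℂ} : z ∈ Dtop ↔ 0 < z.im := by
  rw [Dtop, mem_halfPlane, conj_mul_re]
  simp

/-- `0, 1 ∉ D₀`. [folklore] -/
theorem zero_one_not_mem_D0 : (0 : ℂ) ∉ D0 ∧ (1 : ℂ) ∉ D0 := by
  constructor <;> (rw [mem_D0]; simp)

/-- `0, 1 ∉ D₁`. [folklore] -/
theorem zero_one_not_mem_D1 : (0 : ℂ) ∉ D1 ∧ (1 : ℂ) ∉ D1 := by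
  constructor <;> (rw [mem_D1]; simp)

/-- `0, 1 ∉ D₂`. [folklore] -/
theorem zero_one_not_mem_D2 : (0 : ℂ) ∉ D2 ∧ (1 : ℂ) ∉ D2 := by
  constructor <;> (rw [mem_D2]; simp)

/-- `0, 1 ∉ ℍ`. [folklore] -/
theorem zero_one_not_mem_Dtop : (0 : ℂ) ∉ Dtop ∧ (1 : ℂ) ∉ Dtop := by
  constructor <;> (rw [mem_Dtop]; simp)

/-- **`ρ` maps `D₀` into `D₁`.** [folklore] -/
theorem rho_mem_D1 {z : ℂ} (hz : z ∈ D0) : rho z ∈ D1 := by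
  have h1 : z ≠ 1 := fun h => zero_one_not_mem_D0.2 (h ▸ hz)
  rw [mem_D0] at hz
  rw [mem_D1, (rho_re_im z).1, (rho_re_im z).2]
  set M := (1 - z.re) ^ 2 + z.im ^ 2 with hM_def
  have hM : 0 < M := by
    rcases eq_or_ne z.im 0 with him | him
    · have hre : z.re ≠ 1 := fun h => h1 (Complex.ext (by simpa using h) (by simpa using him))
      have : (1 - z.re) ≠ 0 := sub_ne_zero.mpr (Ne.symm hre)
      positivity
    · positivity
  have key : (1 - z.re) / M - 1 + 2 * (z.im / M) = (z.re * (1 - z.re) - z.im * (z.im - 2)) / M := by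
    field_simp
    rw [hM_def]
    ring
  rw [key]
  exact div_pos (by linarith) hM

/-- **`ρ` maps `D₁` into `D₂`.** [folklore] -/
theorem rho_mem_D2 {z : ℂ} (hz : z ∈ D1) : rho z ∈ D2 := by
  have h1 : z ≠ 1 := fun h => zero_one_not_mem_D1.2 (h ▸ hz)
  rw [mem_D1] at hz
  rw [mem_D2, (rho_re_im z).1, (rho_re_im z).2]
  have hM : 0 < (1 - z.re) ^ 2 + z.im ^ 2 := by
    rcases eq_or_ne z.im 0 with him | him
    · have hre : z.re ≠ 1 := fun h => h1 (Complex.ext (by simpa using h) (by simpa using him))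
      have : (1 - z.re) ≠ 0 := sub_ne_zero.mpr (Ne.symm hre)
      positivity
    · positivity
  rw [show -((1 - z.re) / ((1 - z.re) ^ 2 + z.im ^ 2)) + 2 * (z.im / ((1 - z.re) ^ 2 + z.im ^ 2)) =
      ((z.re - 1) + 2 * z.im) / ((1 - z.re) ^ 2 + z.im ^ 2) by ring]
  exact div_pos hz hM

/-- **`ρ` maps `D₂` into `D₀`.** [folklore] -/
theorem rho_mem_D0 {z : ℂ} (hz : z ∈ D2) : rho z ∈ D0 := by
  have h1 : z ≠ 1 := fun h => zero_one_not_mem_D2.2 (h ▸ hz)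
  rw [mem_D2] at hz
  rw [mem_D0, (rho_re_im z).1, (rho_re_im z).2]
  set M := (1 - z.re) ^ 2 + z.im ^ 2 with hM_def
  have hM : 0 < M := by
    rcases eq_or_ne z.im 0 with him | him
    · have hre : z.re ≠ 1 := fun h => h1 (Complex.ext (by simpa using h) (by simpa using him))
      have : (1 - z.re) ≠ 0 := sub_ne_zero.mpr (Ne.symm hre)
      positivity
    · positivity
  rw [← sub_pos]
  have key : (1 - z.re) / M * (1 - (1 - z.re) / M) - z.im / M * (z.im / M - 2) =
      (-z.re + 2 * z.im) / M := by
    field_simp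
    rw [hM_def]
    ring
  rw [key]
  exact div_pos hz hM

/-- **`ρ` preserves the upper half-plane.** [folklore] -/
theorem rho_mem_Dtop {z : ℂ} (hz : z ∈ Dtop) : rho z ∈ Dtop := by
  rw [mem_Dtop] at hz ⊢
  rw [(rho_re_im z).2]
  positivity

section Domains

/-- The four domains are open. [folklore] -/
theorem isOpen_D : IsOpen D0 ∧ IsOpen D1 ∧ IsOpen D2 ∧ IsOpen Dtop :=
  ⟨isOpen_ball, isOpen_halfPlane _ _, isOpen_halfPlane _ _, isOpen_halfPlane _ _⟩

/-- The four domains are convex. [folklore] -/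
theorem convex_D : Convex ℝ D0 ∧ Convex ℝ D1 ∧ Convex ℝ D2 ∧ Convex ℝ Dtop :=
  ⟨convex_ball _ _, convex_halfPlane _ _, convex_halfPlane _ _, convex_halfPlane _ _⟩

/-- The four domains have primitives (disc: Mathlib; half-planes: `hasPrims_halfPlane`).
[folklore] -/
theorem hasPrims_D : HasPrims D0 ∧ HasPrims D1 ∧ HasPrims D2 ∧ HasPrims Dtop := by
  refine ⟨hasPrims_ball _ _, hasPrims_halfPlane _ ?_, hasPrims_halfPlane _ ?_, hasPrims_halfPlane _ ?_⟩
  · intro h; have := congrArg Complex.im h; simp at this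
  · intro h; have := congrArg Complex.im h; simp at this
  · exact Complex.I_ne_zero

/-- The KZ densities are holomorphic on each of the four domains. [folklore] -/
theorem differentiableOn_fKZ_D (c : Bool) :
    DifferentiableOn ℂ (fKZ c) D0 ∧ DifferentiableOn ℂ (fKZ c) D1 ∧ DifferentiableOn ℂ (fKZ c) D2 ∧
      DifferentiableOn ℂ (fKZ c) Dtop :=
  ⟨differentiableOn_fKZ zero_one_not_mem_D0.1 zero_one_not_mem_D0.2 c,
    differentiableOn_fKZ zero_one_not_mem_D1.1 zero_one_not_mem_D1.2 c,
    differentiableOn_fKZ zero_one_not_mem_D2.1 zero_one_not_mem_D2.2 c,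
    differentiableOn_fKZ zero_one_not_mem_Dtop.1 zero_one_not_mem_Dtop.2 c⟩

end Domains

/-! ## 3. `C¹` paths in `ℂ ∖ {0,1}`: transports, the local path formula, functoriality under `ρ` -/

/-- A **`C¹` path in `ℂ ∖ {0,1}`** on an open set `s` of parameters: the path `γ`, its
derivative `γ'` (continuous on `s`), avoiding the singular points of the KZ form. [folklore] -/
structure KZPath (s : Set ℝ) where
  /-- the path -/
  γ : ℝ → ℂ
  /-- its derivative -/
  γ' : ℝ → ℂ
  hasDeriv : ∀ t ∈ s, HasDerivAt γ (γ' t) t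
  cont : ContinuousOn γ' s
  ne_zero : ∀ t ∈ s, γ t ≠ 0
  ne_one : ∀ t ∈ s, γ t ≠ 1

namespace KZPath

variable {s : Set ℝ}

/-- The path is continuous on `s`. [folklore] -/
theorem continuousOn_γ (d : KZPath s) : ContinuousOn d.γ s := fun t ht =>
  (d.hasDeriv t ht).continuousAt.continuousWithinAt

/-- The **pulled-back densities** `f_c(γ(t)) γ'(t)` of the KZ form along the path. [folklore] -/
def dens (d : KZPath s) : Bool → ℝ → ℂ := fun c t => fKZ c (d.γ t) * d.γ' t

/-- Unfolding `dens`. [folklore] -/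
theorem dens_apply (d : KZPath s) (c : Bool) (t : ℝ) : d.dens c t = fKZ c (d.γ t) * d.γ' t := rfl

/-- The pulled-back densities are continuous on `s`. [folklore] -/
theorem continuousOn_dens (d : KZPath s) (c : Bool) : ContinuousOn (d.dens c) s := by
  intro t ht
  have h1 := (differentiableAt_fKZ c (d.ne_zero t ht) (d.ne_one t ht)).continuousAt
  exact (h1.comp_continuousWithinAt (d.continuousOn_γ t ht)).mul (d.cont t ht)

/-- **The transport** of the KZ form along the path from parameter `a` to `b` (Chen's series of
iterated integrals of the pulled-back densities). [cite: Drinfeld1991, §2] -/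
def T (d : KZPath s) (a b : ℝ) : NCSeries Bool ℂ := ctransport d.dens a b

/-- Chen's rule along a path: `T(b,c) T(a,b) = T(a,c)`. [folklore] -/
theorem T_mul_T (d : KZPath s) (hs : IsOpen s) (hso : s.OrdConnected) {a b c : ℝ} (ha : a ∈ s)
    (hb : b ∈ s) (hc : c ∈ s) : d.T b c * d.T a b = d.T a c :=
  (ctransport_chen hs hso d.continuousOn_dens ha hb hc).symm

/-- **The path formula**: on a domain `U ∌ 0, 1` with primitives, the fundamental solution between
two points of a path in `U` is the transport along the path. [folklore] -/
theorem kzFund_eq_T (d : KZPath s) (hs : IsOpen s) {U : Set ℂ} (hU : HasPrims U) (hUo : IsOpen U)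
    (h0 : (0 : ℂ) ∉ U) (h1 : (1 : ℂ) ∉ U) {a b : ℝ} (hab : a ≤ b) (hIcc : Icc a b ⊆ s)
    (hmaps : MapsTo d.γ (Icc a b) U) : kzFund U fKZ (d.γ a) (d.γ b) = d.T a b :=
  (isKZSol_kzFund hU (differentiableOn_fKZ h0 h1) (d.γ a)).pathOn hUo
    (fun c => (differentiableOn_fKZ h0 h1 c).continuousOn) hs d.hasDeriv d.cont hab hIcc hmaps
    (kzFund_self U fKZ (d.γ a))

/-- **The image path `ρ ∘ γ`** (again a `C¹` path in `ℂ ∖ {0,1}` on `s`). [cite: Drinfeld1991, §2] -/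
def rhoPath (d : KZPath s) : KZPath s where
  γ := fun t => rho (d.γ t)
  γ' := fun t => ((1 - d.γ t) ^ 2)⁻¹ * d.γ' t
  hasDeriv := fun t ht => (hasDerivAt_rho (d.ne_one t ht)).comp t (d.hasDeriv t ht)
  cont := by
    refine ContinuousOn.mul ?_ d.cont
    refine ContinuousOn.inv₀ ((continuousOn_const.sub d.continuousOn_γ).pow 2) fun t ht => ?_
    exact pow_ne_zero 2 (sub_ne_zero.mpr (Ne.symm (d.ne_one t ht)))
  ne_zero := fun t ht => rho_ne_zero (d.ne_one t ht)
  ne_one := fun t ht => rho_ne_one (d.ne_zero t ht)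

/-- The image path is `ρ ∘ γ`. [folklore] -/
@[simp] theorem rhoPath_γ (d : KZPath s) (t : ℝ) : d.rhoPath.γ t = rho (d.γ t) := rfl

/-- **Functoriality of the transport under `ρ`**: the transport along `ρ ∘ γ` is `σ̂ = push mrho`
of the transport along `γ` (the pull-back `ρ^*ω` is `ω` with `A ↦ B`, `B ↦ -A-B`).
[cite: Drinfeld1991, §2] -/
theorem T_rhoPath (d : KZPath s) (hs : IsOpen s) (hso : s.OrdConnected) {a b : ℝ} (ha : a ∈ s)
    (hb : b ∈ s) : d.rhoPath.T a b = NCSeries.push mrho (d.T a b) := by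
  unfold T
  rw [← ctransport_linComb hs hso d.continuousOn_dens ha mrho hb]
  funext w
  rw [ctransport_apply, ctransport_apply]
  refine citerInt_congr (fun c t ht => ?_) w right_mem_uIcc
  have hts : t ∈ s := hso.uIcc_subset ha hb ht
  rw [dens_apply, rhoPath_γ, show d.rhoPath.γ' t = ((1 - d.γ t) ^ 2)⁻¹ * d.γ' t from rfl,
    ← mul_assoc, fKZ_rho c (d.ne_zero t hts) (d.ne_one t hts), Finset.sum_mul]
  refine Finset.sum_congr rfl fun b _ => ?_
  rw [dens_apply, mul_assoc]

end KZPath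

/-! ### The straight path along the real axis and the half-circle around `1` -/

/-- **The real-axis path** `t ↦ t` on an open set of parameters avoiding `0` and `1`.
[folklore] -/
def linePath (s : Set ℝ) (h0 : (0 : ℝ) ∉ s) (h1 : (1 : ℝ) ∉ s) : KZPath s where
  γ := fun t => (t : ℂ)
  γ' := fun _ => 1
  hasDeriv := fun t _ => by simpa using (hasDerivAt_id t).ofReal_comp
  cont := continuousOn_const
  ne_zero := fun t ht h => h0 (by rwa [Complex.ofReal_eq_zero.mp h] at ht)
  ne_one := fun t ht h => h1 (by rwa [Complex.ofReal_eq_one.mp h] at ht)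

/-- Along the real axis the complex transport is the real KZ transport of
`DrinfeldAssociatorLimit.lean` (`KZ3.kzTransport = transportSeries KZ3.F₀`). [folklore] -/
theorem linePath_T (s : Set ℝ) (h0 : (0 : ℝ) ∉ s) (h1 : (1 : ℝ) ∉ s) (a b : ℝ) :
    (linePath s h0 h1).T a b = NCSeries.map (algebraMap ℝ ℂ) (transportSeries KZ3.F₀ a b) := by
  rw [KZPath.T, ← ctransport_ofReal]
  congr 1
  funext c t
  rw [KZPath.dens_apply, show (linePath s h0 h1).γ t = (t : ℂ) from rfl,
    show (linePath s h0 h1).γ' t = 1 from rfl, mul_one, fKZ_ofReal]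

section Circle

variable (ε : ℝ)

/-- The unit vector `e^{i(π - t)}`. [folklore] -/
def cexpπ (t : ℝ) : ℂ := Complex.exp (((Real.pi - t : ℝ) : ℂ) * I)

/-- `|e^{i(π-t)}| = 1`. [folklore] -/
theorem norm_cexpπ (t : ℝ) : ‖cexpπ t‖ = 1 := by
  rw [cexpπ, Complex.norm_exp_ofReal_mul_I]

/-- `e^{i(π-t)} ≠ 0`. [folklore] -/
theorem cexpπ_ne_zero (t : ℝ) : cexpπ t ≠ 0 := by
  rw [cexpπ]; exact Complex.exp_ne_zero _

/-- `t ↦ e^{i(π-t)}` is continuous. [folklore] -/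
theorem continuous_cexpπ : Continuous cexpπ := by
  unfold cexpπ; fun_prop

/-- `d/dt e^{i(π-t)} = -i e^{i(π-t)}`. [folklore] -/
theorem hasDerivAt_cexpπ (t : ℝ) : HasDerivAt cexpπ (cexpπ t * (-I)) t := by
  have h1 : HasDerivAt (fun t : ℝ => ((Real.pi - t : ℝ) : ℂ)) ((-1 : ℝ) : ℂ) t :=
    ((hasDerivAt_id t).const_sub Real.pi).ofReal_comp
  have h2 := (h1.mul_const I).cexp
  rw [show (((-1 : ℝ) : ℂ) * I) = -I by push_cast; ring] at h2
  exact h2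

variable {ε} (hε : 0 < ε) (hε1 : ε < 1)
include hε hε1

/-- **The half-circle path** `t ↦ 1 + ε e^{i(π-t)}` around `1` (from `1-ε` at `t = 0` over
`1+iε` at `t = π/2` to `1+ε` at `t = π`, through the upper half plane), for `0 < ε < 1`.
[cite: Drinfeld1991, §2] -/
def circPath : KZPath univ where
  γ := fun t => 1 + (ε : ℂ) * cexpπ t
  γ' := fun t => (ε : ℂ) * (cexpπ t * (-I))
  hasDeriv := fun t _ => ((hasDerivAt_cexpπ t).const_mul (ε : ℂ)).const_add 1
  cont := (continuous_const.mul (continuous_cexpπ.mul continuous_const)).continuousOn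
  ne_zero := fun t _ h => by
    have h' : (ε : ℂ) * cexpπ t = -1 := by linear_combination h
    have := congrArg (‖·‖) h'
    simp only [norm_mul, Complex.norm_real, Real.norm_eq_abs, norm_cexpπ, mul_one, norm_neg,
      norm_one, abs_of_pos hε] at this
    linarith
  ne_one := fun t _ h => by
    have h' : (ε : ℂ) * cexpπ t = 0 := by linear_combination h
    rcases mul_eq_zero.mp h' with h'' | h''
    · exact hε.ne' (Complex.ofReal_eq_zero.mp h'')
    · exact cexpπ_ne_zero t h''

/-- The half-circle path, unfolded. [folklore] -/
theorem circPath_γ (t : ℝ) : (circPath hε hε1).γ t = 1 + (ε : ℂ) * cexpπ t := rfl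

/-- `γ(0) = 1 - ε`. [folklore] -/
theorem circPath_zero : (circPath hε hε1).γ 0 = ((1 - ε : ℝ) : ℂ) := by
  rw [circPath_γ, cexpπ, sub_zero, Complex.exp_pi_mul_I]; push_cast; ring

/-- `γ(π) = 1 + ε`. [folklore] -/
theorem circPath_pi : (circPath hε hε1).γ Real.pi = ((1 + ε : ℝ) : ℂ) := by
  rw [circPath_γ, cexpπ, sub_self]; push_cast; simp

/-- `γ(π/2) = 1 + iε`. [folklore] -/
theorem circPath_pi_div_two : (circPath hε hε1).γ (Real.pi / 2) = 1 + (ε : ℂ) * I := by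
  rw [circPath_γ, cexpπ, show ((Real.pi - Real.pi / 2 : ℝ) : ℂ) = (Real.pi : ℂ) / 2 by push_cast; ring,
    Complex.exp_pi_div_two_mul_I]

/-- Real and imaginary parts along the half-circle: `1 - ε cos t` and `ε sin t`. [folklore] -/
theorem circPath_re_im (t : ℝ) :
    ((circPath hε hε1).γ t).re = 1 - ε * Real.cos t ∧ ((circPath hε hε1).γ t).im = ε * Real.sin t := by
  rw [circPath_γ, cexpπ]
  constructor
  · rw [Complex.add_re, Complex.one_re, Complex.re_ofReal_mul, Complex.exp_ofReal_mul_I_re,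
      Real.cos_pi_sub]; ring
  · rw [Complex.add_im, Complex.one_im, Complex.im_ofReal_mul, Complex.exp_ofReal_mul_I_im,
      Real.sin_pi_sub, zero_add]

/-- **The `B`-density along the half-circle is the constant `-i`** (`dz/(z-1) = -i dt`).
[cite: Drinfeld1991, §2] -/
theorem circPath_dens_true (t : ℝ) : (circPath hε hε1).dens true t = -I := by
  rw [KZPath.dens_apply, fKZ_true, circPath_γ, show (circPath hε hε1).γ' t =
    (ε : ℂ) * (cexpπ t * (-I)) from rfl, add_sub_cancel_left]
  have hε' : (ε : ℂ) ≠ 0 := Complex.ofReal_ne_zero.mpr hε.ne'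
  have he : cexpπ t ≠ 0 := cexpπ_ne_zero t
  field_simp

/-- **The `A`-density along the half-circle is `O(ε)`**: `|dz/z| ≤ ε/(1-ε) dt`. [folklore] -/
theorem norm_circPath_dens_false_le (t : ℝ) : ‖(circPath hε hε1).dens false t‖ ≤ ε / (1 - ε) := by
  rw [KZPath.dens_apply, fKZ_false, circPath_γ, show (circPath hε hε1).γ' t =
    (ε : ℂ) * (cexpπ t * (-I)) from rfl, norm_mul, norm_inv, norm_mul, norm_mul, norm_neg,
    Complex.norm_I, mul_one, norm_cexpπ, mul_one, Complex.norm_real, Real.norm_eq_abs, abs_of_pos hε]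
  have hlow : 1 - ε ≤ ‖1 + (ε : ℂ) * cexpπ t‖ := by
    have h := norm_sub_norm_le (1 : ℂ) (-((ε : ℂ) * cexpπ t))
    rw [sub_neg_eq_add, norm_neg, norm_mul, Complex.norm_real, Real.norm_eq_abs, abs_of_pos hε,
      norm_cexpπ, mul_one, norm_one] at h
    exact h
  have h1ε : 0 < 1 - ε := by linarith
  rw [inv_mul_le_iff₀ (h1ε.trans_le hlow), div_eq_mul_inv]
  calc ε = ε / (1 - ε) * (1 - ε) := by field_simp
    _ ≤ ε / (1 - ε) * ‖1 + (ε : ℂ) * cexpπ t‖ :=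
        mul_le_mul_of_nonneg_left hlow (div_nonneg hε.le h1ε.le)
    _ = ‖1 + (ε : ℂ) * cexpπ t‖ * (ε * (1 - ε)⁻¹) := by ring

/-! ### Memberships of the base pieces in the domains -/

omit hε hε1 in
/-- `(0,1) ⊂ D₀`. [folklore] -/
theorem ofReal_mem_D0 {t : ℝ} (ht : t ∈ Ioo (0 : ℝ) 1) : (t : ℂ) ∈ D0 := by
  rw [mem_D0]; simp; nlinarith [ht.1, ht.2]

omit hε hε1 in
/-- `(1,∞) ⊂ D₁`. [folklore] -/
theorem ofReal_mem_D1 {t : ℝ} (ht : 1 < t) : (t : ℂ) ∈ D1 := by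
  rw [mem_D1]; simp; linarith

/-- The first quarter of the half-circle lies in `D₀`. [folklore] -/
theorem circPath_mem_D0 {t : ℝ} (ht : t ∈ Icc 0 (Real.pi / 2)) : (circPath hε hε1).γ t ∈ D0 := by
  rw [mem_D0, (circPath_re_im hε hε1 t).1, (circPath_re_im hε hε1 t).2]
  have hs : 0 ≤ Real.sin t := Real.sin_nonneg_of_nonneg_of_le_pi ht.1 (by linarith [ht.2, Real.pi_pos])
  have hc : 0 ≤ Real.cos t := Real.cos_nonneg_of_mem_Icc ⟨by linarith [ht.1, Real.pi_pos], ht.2⟩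
  have h1 := Real.sin_sq_add_cos_sq t
  have hsc : 1 ≤ Real.sin t + Real.cos t := by
    by_contra hlt
    push Not at hlt
    nlinarith [mul_nonneg hs hc, mul_pos (by linarith : 0 < 1 - (Real.sin t + Real.cos t))
      (by linarith : 0 < 1 + (Real.sin t + Real.cos t))]
  have key : (1 - ε * Real.cos t) * (1 - (1 - ε * Real.cos t)) - ε * Real.sin t * (ε * Real.sin t - 2) =
      ε * (2 * Real.sin t + Real.cos t - ε) := by
    have h2 : ε * (2 * Real.sin t + Real.cos t - ε) =
        2 * ε * Real.sin t + ε * Real.cos t - ε ^ 2 * (Real.sin t ^ 2 + Real.cos t ^ 2) := by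
      rw [h1]; ring
    rw [h2]; ring
  rw [← sub_pos, key]
  exact mul_pos hε (by linarith)

/-- The second quarter of the half-circle lies in `D₁`. [folklore] -/
theorem circPath_mem_D1 {t : ℝ} (ht : t ∈ Icc (Real.pi / 2) Real.pi) : (circPath hε hε1).γ t ∈ D1 := by
  rw [mem_D1, (circPath_re_im hε hε1 t).1, (circPath_re_im hε hε1 t).2]
  have hs : 0 ≤ Real.sin t := Real.sin_nonneg_of_nonneg_of_le_pi (by linarith [ht.1, Real.pi_pos]) ht.2
  have hc : Real.cos t ≤ 0 := Real.cos_nonpos_of_pi_div_two_le_of_le ht.1 (by linarith [ht.2, Real.pi_pos])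
  have h1 := Real.sin_sq_add_cos_sq t
  have key : 1 ≤ 2 * Real.sin t - Real.cos t := by
    nlinarith [mul_nonneg hs (neg_nonneg.mpr hc)]
  nlinarith

/-- The junction `1 + iε` lies in the hub `ℍ`. [folklore] -/
theorem circPath_pi_div_two_mem_Dtop : (circPath hε hε1).γ (Real.pi / 2) ∈ Dtop := by
  rw [mem_Dtop, circPath_pi_div_two]; simpa using hε

end Circle

/-! ## 4. The pieces of the contour and the loop identity -/

/-- The densities along the real axis. [folklore] -/
def lineDens : Bool → ℝ → ℂ := fun c t => fKZ c t * 1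

/-- The densities along the half-circle of radius `ε` around `1`. [folklore] -/
def circDens (ε : ℝ) : Bool → ℝ → ℂ := fun c t =>
  fKZ c (1 + (ε : ℂ) * cexpπ t) * ((ε : ℂ) * (cexpπ t * (-I)))

/-- **`seg = T(P₁)`**: the transport along `[ε, 1-ε]`. [cite: Drinfeld1991, §2] -/
def seg (ε : ℝ) : NCSeries Bool ℂ := ctransport lineDens ε (1 - ε)

/-- The transport along the mini-segment `[1+ε, 1+ε/(1-ε)] = [1+ε, ρ(ε)]`. [folklore] -/
def mini (ε : ℝ) : NCSeries Bool ℂ := ctransport lineDens (1 + ε) (1 + ε / (1 - ε))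

/-- The transport along the first quarter of the half-circle (`1-ε → 1+iε`). [folklore] -/
def cA (ε : ℝ) : NCSeries Bool ℂ := ctransport (circDens ε) 0 (Real.pi / 2)

/-- The transport along the second quarter of the half-circle (`1+iε → 1+ε`). [folklore] -/
def cB (ε : ℝ) : NCSeries Bool ℂ := ctransport (circDens ε) (Real.pi / 2) Real.pi

/-- The transport along the whole half-circle (`1-ε → 1+ε` over `1`). [folklore] -/
def circT (ε : ℝ) : NCSeries Bool ℂ := ctransport (circDens ε) 0 Real.pi

/-- **`cap = T(P₂)`**: half-circle followed by the mini-segment. [cite: Drinfeld1991, §2] -/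
def cap (ε : ℝ) : NCSeries Bool ℂ := mini ε * circT ε

/-- The transport of a line path is `ctransport lineDens`. [folklore] -/
theorem linePath_T_eq (s : Set ℝ) (h0 : (0 : ℝ) ∉ s) (h1 : (1 : ℝ) ∉ s) (a b : ℝ) :
    (linePath s h0 h1).T a b = ctransport lineDens a b := rfl

/-- The transport of the half-circle path is `ctransport (circDens ε)`. [folklore] -/
theorem circPath_T_eq {ε : ℝ} (hε : 0 < ε) (hε1 : ε < 1) (a b : ℝ) :
    (circPath hε hε1).T a b = ctransport (circDens ε) a b := rfl

/-- **`seg` is the real KZ transport** `KZ3.kzTransport ε (1-ε)` of `DrinfeldAssociatorLimit.lean`.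
[folklore] -/
theorem seg_eq_map_kzTransport (ε : ℝ) :
    seg ε = NCSeries.map (algebraMap ℝ ℂ) (KZ3.kzTransport ε (1 - ε)) := by
  rw [seg, ← linePath_T_eq (Ioo 0 1) (by simp) (by simp), linePath_T]; rfl

/-- The whole half-circle is the product of its two quarters (Chen). [folklore] -/
theorem cB_mul_cA {ε : ℝ} (hε : 0 < ε) (hε1 : ε < 1) : cB ε * cA ε = circT ε := by
  rw [cB, cA, circT, ← circPath_T_eq hε hε1, ← circPath_T_eq hε hε1, ← circPath_T_eq hε hε1]
  exact (circPath hε hε1).T_mul_T isOpen_univ ordConnected_univ (mem_univ _) (mem_univ _) (mem_univ _)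

section Loop

variable {ε : ℝ} (hε : 0 < ε) (hε2 : ε < 1 / 2)
include hε hε2

/-- `ρ(ε) = 1 + ε/(1-ε)`. [folklore] -/
theorem rho_eps : rho ((ε : ℝ) : ℂ) = ((1 + ε / (1 - ε) : ℝ) : ℂ) := by
  have h : (1 : ℝ) - ε ≠ 0 := by linarith
  have h' : (1 : ℂ) - ε ≠ 0 := by exact_mod_cast h
  rw [rho, show (1 + ε / (1 - ε) : ℝ) = (1 - ε)⁻¹ by field_simp; ring]
  push_cast
  ring

/-- **The loop identity** [Drinfeld1991, §2]: the total transport of the KZ form around the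
contour `P₁ P₂ ρ(P₁) ρ(P₂) ρ²(P₁) ρ²(P₂)` based at `ε` is trivial:
`σ̂²(mini) σ̂²(c_B) σ̂²(c_A) σ̂²(seg) · σ̂(mini) σ̂(c_B) σ̂(c_A) σ̂(seg) · mini c_B c_A seg = 1`.
Proof: holomorphic fundamental solutions on `D₀, D₁, D₂` and the hub `ℍ`, Chen's rule inside each,
agreement on overlaps, the path formula and the functoriality under `ρ`.
[cite: Drinfeld1991, §2, (2.12)] -/
theorem loop_identity :
    NCSeries.push mrho (NCSeries.push mrho (mini ε)) * NCSeries.push mrho (NCSeries.push mrho (cB ε)) *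
      NCSeries.push mrho (NCSeries.push mrho (cA ε)) * NCSeries.push mrho (NCSeries.push mrho (seg ε)) *
      NCSeries.push mrho (mini ε) * NCSeries.push mrho (cB ε) * NCSeries.push mrho (cA ε) *
      NCSeries.push mrho (seg ε) * mini ε * cB ε * cA ε * seg ε = 1 := by
  have hε1 : ε < 1 := by linarith
  have h1ε : (0 : ℝ) < 1 - ε := by linarith
  -- the paths
  set P := circPath hε hε1 with hP
  have hI0 : (0 : ℝ) ∉ Ioo (0 : ℝ) 1 := by simp
  have hI1 : (1 : ℝ) ∉ Ioo (0 : ℝ) 1 := by simp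
  have hJ0 : (0 : ℝ) ∉ Ioi (1 : ℝ) := by simp
  have hJ1 : (1 : ℝ) ∉ Ioi (1 : ℝ) := by simp
  set Lm := linePath (Ioo (0 : ℝ) 1) hI0 hI1 with hLm
  set Li := linePath (Ioi (1 : ℝ)) hJ0 hJ1 with hLi
  -- domain data
  obtain ⟨hP0, hP1, hP2, hPt⟩ := hasPrims_D
  obtain ⟨hO0, hO1, hO2, hOt⟩ := isOpen_D
  obtain ⟨hC0, hC1, hC2, hCt⟩ := convex_D
  have hf0 : ∀ c, DifferentiableOn ℂ (fKZ c) D0 := fun c => (differentiableOn_fKZ_D c).1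
  have hf1 : ∀ c, DifferentiableOn ℂ (fKZ c) D1 := fun c => (differentiableOn_fKZ_D c).2.1
  have hf2 : ∀ c, DifferentiableOn ℂ (fKZ c) D2 := fun c => (differentiableOn_fKZ_D c).2.2.1
  have hft : ∀ c, DifferentiableOn ℂ (fKZ c) Dtop := fun c => (differentiableOn_fKZ_D c).2.2.2
  -- points
  set z₃ : ℂ := P.γ (Real.pi / 2) with hz₃
  have e1 : P.γ 0 = ((1 - ε : ℝ) : ℂ) := circPath_zero hε hε1
  have e2 : P.γ Real.pi = ((1 + ε : ℝ) : ℂ) := circPath_pi hε hε1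
  have e3 : rho ((ε : ℝ) : ℂ) = ((1 + ε / (1 - ε) : ℝ) : ℂ) := rho_eps hε hε2
  have hε0' : ((ε : ℝ) : ℂ) ≠ 0 := Complex.ofReal_ne_zero.mpr hε.ne'
  have hε1' : ((ε : ℝ) : ℂ) ≠ 1 := fun h => by
    have := Complex.ofReal_eq_one.mp h; linarith
  have e4 : rho (rho (rho ((ε : ℝ) : ℂ))) = ε := rho_rho_rho hε0' hε1'
  -- memberships of points
  have mε : ((ε : ℝ) : ℂ) ∈ D0 := ofReal_mem_D0 ⟨hε, hε1⟩
  have m1ε : ((1 - ε : ℝ) : ℂ) ∈ D0 := ofReal_mem_D0 ⟨h1ε, by linarith⟩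
  have mz₃0 : z₃ ∈ D0 := circPath_mem_D0 hε hε1 ⟨by positivity, le_rfl⟩
  have mz₃1 : z₃ ∈ D1 := circPath_mem_D1 hε hε1 ⟨le_rfl, by linarith [Real.pi_pos]⟩
  have mz₃t : z₃ ∈ Dtop := circPath_pi_div_two_mem_Dtop hε hε1
  have m1pε : ((1 + ε : ℝ) : ℂ) ∈ D1 := ofReal_mem_D1 (by linarith)
  have mρε : rho ((ε : ℝ) : ℂ) ∈ D1 := rho_mem_D1 mε
  have mρ1ε : rho ((1 - ε : ℝ) : ℂ) ∈ D1 := rho_mem_D1 m1ε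
  have mρz₃1 : rho z₃ ∈ D1 := rho_mem_D1 mz₃0
  have mρz₃2 : rho z₃ ∈ D2 := rho_mem_D2 mz₃1
  have mρz₃t : rho z₃ ∈ Dtop := rho_mem_Dtop mz₃t
  have mρ1pε : rho ((1 + ε : ℝ) : ℂ) ∈ D2 := rho_mem_D2 m1pε
  have mρρε : rho (rho ((ε : ℝ) : ℂ)) ∈ D2 := rho_mem_D2 mρε
  have mρρ1ε : rho (rho ((1 - ε : ℝ) : ℂ)) ∈ D2 := rho_mem_D2 mρ1ε
  have mρρz₃2 : rho (rho z₃) ∈ D2 := rho_mem_D2 mρz₃1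
  have mρρz₃0 : rho (rho z₃) ∈ D0 := rho_mem_D0 mρz₃2
  have mρρz₃t : rho (rho z₃) ∈ Dtop := rho_mem_Dtop mρz₃t
  -- parameter intervals
  have hIcc1 : Icc ε (1 - ε) ⊆ Ioo (0 : ℝ) 1 := fun t ht => ⟨by linarith [ht.1], by linarith [ht.2]⟩
  have hab1 : ε ≤ 1 - ε := by linarith
  have hεp : ε < ε / (1 - ε) := by
    rw [lt_div_iff₀ h1ε]; nlinarith
  have hIcc4 : Icc (1 + ε) (1 + ε / (1 - ε)) ⊆ Ioi (1 : ℝ) := fun t ht => by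
    simp only [mem_Ioi]; linarith [ht.1]
  have hab4 : 1 + ε ≤ 1 + ε / (1 - ε) := by linarith
  have habA : (0 : ℝ) ≤ Real.pi / 2 := by positivity
  have habB : Real.pi / 2 ≤ Real.pi := by linarith [Real.pi_pos]
  -- maps
  have mapsLm : ∀ t ∈ Icc ε (1 - ε), Lm.γ t ∈ D0 := fun t ht => ofReal_mem_D0 (hIcc1 ht)
  have mapsLi : ∀ t ∈ Icc (1 + ε) (1 + ε / (1 - ε)), Li.γ t ∈ D1 := fun t ht =>
    ofReal_mem_D1 (hIcc4 ht)
  have mapsA : ∀ t ∈ Icc 0 (Real.pi / 2), P.γ t ∈ D0 := fun t ht => circPath_mem_D0 hε hε1 ht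
  have mapsB : ∀ t ∈ Icc (Real.pi / 2) Real.pi, P.γ t ∈ D1 := fun t ht => circPath_mem_D1 hε hε1 ht
  -- the twelve path formulas
  have f1 : kzFund D0 fKZ ε ((1 - ε : ℝ) : ℂ) = seg ε :=
    Lm.kzFund_eq_T isOpen_Ioo hP0 hO0 zero_one_not_mem_D0.1 zero_one_not_mem_D0.2 hab1 hIcc1 mapsLm
  have f2 : kzFund D0 fKZ (P.γ 0) z₃ = cA ε :=
    P.kzFund_eq_T isOpen_univ hP0 hO0 zero_one_not_mem_D0.1 zero_one_not_mem_D0.2 habA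
      (subset_univ _) mapsA
  have f3 : kzFund D1 fKZ z₃ (P.γ Real.pi) = cB ε :=
    P.kzFund_eq_T isOpen_univ hP1 hO1 zero_one_not_mem_D1.1 zero_one_not_mem_D1.2 habB
      (subset_univ _) mapsB
  have f4 : kzFund D1 fKZ ((1 + ε : ℝ) : ℂ) ((1 + ε / (1 - ε) : ℝ) : ℂ) = mini ε :=
    Li.kzFund_eq_T isOpen_Ioi hP1 hO1 zero_one_not_mem_D1.1 zero_one_not_mem_D1.2 hab4 hIcc4 mapsLi
  have f5 : kzFund D1 fKZ (rho ε) (rho ((1 - ε : ℝ) : ℂ)) = NCSeries.push mrho (seg ε) := by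
    rw [seg, ← linePath_T_eq (Ioo 0 1) hI0 hI1, ← hLm,
      ← Lm.T_rhoPath isOpen_Ioo ordConnected_Ioo ⟨hε, hε1⟩ ⟨h1ε, by linarith⟩]
    exact Lm.rhoPath.kzFund_eq_T isOpen_Ioo hP1 hO1 zero_one_not_mem_D1.1 zero_one_not_mem_D1.2
      hab1 hIcc1 fun t ht => rho_mem_D1 (mapsLm t ht)
  have f6 : kzFund D1 fKZ (rho (P.γ 0)) (rho z₃) = NCSeries.push mrho (cA ε) := by
    rw [cA, ← circPath_T_eq hε hε1, ← hP,
      ← P.T_rhoPath isOpen_univ ordConnected_univ (mem_univ _) (mem_univ _)]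
    exact P.rhoPath.kzFund_eq_T isOpen_univ hP1 hO1 zero_one_not_mem_D1.1 zero_one_not_mem_D1.2
      habA (subset_univ _) fun t ht => rho_mem_D1 (mapsA t ht)
  have f7 : kzFund D2 fKZ (rho z₃) (rho (P.γ Real.pi)) = NCSeries.push mrho (cB ε) := by
    rw [cB, ← circPath_T_eq hε hε1, ← hP,
      ← P.T_rhoPath isOpen_univ ordConnected_univ (mem_univ _) (mem_univ _)]
    exact P.rhoPath.kzFund_eq_T isOpen_univ hP2 hO2 zero_one_not_mem_D2.1 zero_one_not_mem_D2.2
      habB (subset_univ _) fun t ht => rho_mem_D2 (mapsB t ht)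
  have f8 : kzFund D2 fKZ (rho ((1 + ε : ℝ) : ℂ)) (rho ((1 + ε / (1 - ε) : ℝ) : ℂ)) =
      NCSeries.push mrho (mini ε) := by
    rw [mini, ← linePath_T_eq (Ioi 1) hJ0 hJ1, ← hLi,
      ← Li.T_rhoPath isOpen_Ioi ordConnected_Ioi (by simp [hε] : 1 + ε ∈ Ioi (1 : ℝ))
        (by simp only [mem_Ioi]; linarith : 1 + ε / (1 - ε) ∈ Ioi (1 : ℝ))]
    exact Li.rhoPath.kzFund_eq_T isOpen_Ioi hP2 hO2 zero_one_not_mem_D2.1 zero_one_not_mem_D2.2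
      hab4 hIcc4 fun t ht => rho_mem_D2 (mapsLi t ht)
  have f9 : kzFund D2 fKZ (rho (rho ε)) (rho (rho ((1 - ε : ℝ) : ℂ))) =
      NCSeries.push mrho (NCSeries.push mrho (seg ε)) := by
    rw [seg, ← linePath_T_eq (Ioo 0 1) hI0 hI1, ← hLm,
      ← Lm.T_rhoPath isOpen_Ioo ordConnected_Ioo ⟨hε, hε1⟩ ⟨h1ε, by linarith⟩,
      ← Lm.rhoPath.T_rhoPath isOpen_Ioo ordConnected_Ioo ⟨hε, hε1⟩ ⟨h1ε, by linarith⟩]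
    exact Lm.rhoPath.rhoPath.kzFund_eq_T isOpen_Ioo hP2 hO2 zero_one_not_mem_D2.1
      zero_one_not_mem_D2.2 hab1 hIcc1 fun t ht => rho_mem_D2 (rho_mem_D1 (mapsLm t ht))
  have f10 : kzFund D2 fKZ (rho (rho (P.γ 0))) (rho (rho z₃)) =
      NCSeries.push mrho (NCSeries.push mrho (cA ε)) := by
    rw [cA, ← circPath_T_eq hε hε1, ← hP,
      ← P.T_rhoPath isOpen_univ ordConnected_univ (mem_univ _) (mem_univ _),
      ← P.rhoPath.T_rhoPath isOpen_univ ordConnected_univ (mem_univ _) (mem_univ _)]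
    exact P.rhoPath.rhoPath.kzFund_eq_T isOpen_univ hP2 hO2 zero_one_not_mem_D2.1
      zero_one_not_mem_D2.2 habA (subset_univ _) fun t ht => rho_mem_D2 (rho_mem_D1 (mapsA t ht))
  have f11 : kzFund D0 fKZ (rho (rho z₃)) (rho (rho (P.γ Real.pi))) =
      NCSeries.push mrho (NCSeries.push mrho (cB ε)) := by
    rw [cB, ← circPath_T_eq hε hε1, ← hP,
      ← P.T_rhoPath isOpen_univ ordConnected_univ (mem_univ _) (mem_univ _),
      ← P.rhoPath.T_rhoPath isOpen_univ ordConnected_univ (mem_univ _) (mem_univ _)]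
    exact P.rhoPath.rhoPath.kzFund_eq_T isOpen_univ hP0 hO0 zero_one_not_mem_D0.1
      zero_one_not_mem_D0.2 habB (subset_univ _) fun t ht => rho_mem_D0 (rho_mem_D2 (mapsB t ht))
  have f12 : kzFund D0 fKZ (rho (rho ((1 + ε : ℝ) : ℂ))) (rho (rho ((1 + ε / (1 - ε) : ℝ) : ℂ))) =
      NCSeries.push mrho (NCSeries.push mrho (mini ε)) := by
    rw [mini, ← linePath_T_eq (Ioi 1) hJ0 hJ1, ← hLi,
      ← Li.T_rhoPath isOpen_Ioi ordConnected_Ioi (by simp [hε] : 1 + ε ∈ Ioi (1 : ℝ))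
        (by simp only [mem_Ioi]; linarith : 1 + ε / (1 - ε) ∈ Ioi (1 : ℝ)),
      ← Li.rhoPath.T_rhoPath isOpen_Ioi ordConnected_Ioi (by simp [hε] : 1 + ε ∈ Ioi (1 : ℝ))
        (by simp only [mem_Ioi]; linarith : 1 + ε / (1 - ε) ∈ Ioi (1 : ℝ))]
    exact Li.rhoPath.rhoPath.kzFund_eq_T isOpen_Ioi hP0 hO0 zero_one_not_mem_D0.1
      zero_one_not_mem_D0.2 hab4 hIcc4 fun t ht => rho_mem_D0 (rho_mem_D2 (mapsLi t ht))
  -- Chen inside each domain, and agreement on overlaps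
  have chen0 := kzFund_mul_kzFund hP0 hf0 hO0 hC0
  have chen1 := kzFund_mul_kzFund hP1 hf1 hO1 hC1
  have chen2 := kzFund_mul_kzFund hP2 hf2 hO2 hC2
  have chent := kzFund_mul_kzFund hPt hft hOt hCt
  rw [← f9, ← f10, ← f11, ← f12, ← f5, ← f6, ← f7, ← f8, ← f1, ← f2, ← f3, ← f4, e1, e2, ← e3]
  -- the four blocks
  have hM1 : kzFund D0 fKZ ((1 - ε : ℝ) : ℂ) z₃ * kzFund D0 fKZ ε ((1 - ε : ℝ) : ℂ) =
      kzFund D0 fKZ ε z₃ := chen0 _ m1ε _ mz₃0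
  have hR : kzFund D1 fKZ (rho ((1 - ε : ℝ) : ℂ)) (rho z₃) *
      kzFund D1 fKZ (rho ε) (rho ((1 - ε : ℝ) : ℂ)) *
      kzFund D1 fKZ ((1 + ε : ℝ) : ℂ) (rho ε) * kzFund D1 fKZ z₃ ((1 + ε : ℝ) : ℂ) =
      kzFund D1 fKZ z₃ (rho z₃) := by
    rw [mul_assoc, chen1 _ m1pε _ mρε, mul_assoc, chen1 _ mρε _ mρ1ε, chen1 _ mρ1ε _ mρz₃1]
  have hL : kzFund D2 fKZ (rho (rho ((1 - ε : ℝ) : ℂ))) (rho (rho z₃)) *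
      kzFund D2 fKZ (rho (rho ε)) (rho (rho ((1 - ε : ℝ) : ℂ))) *
      kzFund D2 fKZ (rho ((1 + ε : ℝ) : ℂ)) (rho (rho ε)) *
      kzFund D2 fKZ (rho z₃) (rho ((1 + ε : ℝ) : ℂ)) =
      kzFund D2 fKZ (rho z₃) (rho (rho z₃)) := by
    rw [mul_assoc, chen2 _ mρ1pε _ mρρε, mul_assoc, chen2 _ mρρε _ mρρ1ε, chen2 _ mρρ1ε _ mρρz₃2]
  have hM2 : kzFund D0 fKZ (rho (rho ((1 + ε : ℝ) : ℂ))) (rho (rho (rho ε))) *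
      kzFund D0 fKZ (rho (rho z₃)) (rho (rho ((1 + ε : ℝ) : ℂ))) =
      kzFund D0 fKZ (rho (rho z₃)) ε := by
    rw [e4]
    exact chen0 _ (rho_mem_D0 mρ1pε) _ mε
  -- hub
  have aR : kzFund D1 fKZ z₃ (rho z₃) = kzFund Dtop fKZ z₃ (rho z₃) :=
    kzFund_eq_on_inter hP1 hf1 hPt hft hO1 hOt hC1 hCt mz₃1 mz₃t _ ⟨mρz₃1, mρz₃t⟩
  have aL : kzFund D2 fKZ (rho z₃) (rho (rho z₃)) = kzFund Dtop fKZ (rho z₃) (rho (rho z₃)) :=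
    kzFund_eq_on_inter hP2 hf2 hPt hft hO2 hOt hC2 hCt mρz₃2 mρz₃t _ ⟨mρρz₃2, mρρz₃t⟩
  have aM : kzFund Dtop fKZ z₃ (rho (rho z₃)) = kzFund D0 fKZ z₃ (rho (rho z₃)) :=
    (kzFund_eq_on_inter hP0 hf0 hPt hft hO0 hOt hC0 hCt mz₃0 mz₃t _ ⟨mρρz₃0, mρρz₃t⟩).symm
  have hHub : kzFund D2 fKZ (rho z₃) (rho (rho z₃)) * kzFund D1 fKZ z₃ (rho z₃) =
      kzFund D0 fKZ z₃ (rho (rho z₃)) := by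
    rw [aR, aL, chent _ mρz₃t _ mρρz₃t, aM]
  have hfin : kzFund D0 fKZ (rho (rho z₃)) ε * kzFund D0 fKZ z₃ (rho (rho z₃)) *
      kzFund D0 fKZ ε z₃ = 1 := by
    rw [chen0 _ mρρz₃0 _ mε, chen0 _ mz₃0 _ mε, kzFund_self]
  calc _ = (kzFund D0 fKZ (rho (rho ((1 + ε : ℝ) : ℂ))) (rho (rho (rho ε))) *
        kzFund D0 fKZ (rho (rho z₃)) (rho (rho ((1 + ε : ℝ) : ℂ)))) *
      (kzFund D2 fKZ (rho (rho ((1 - ε : ℝ) : ℂ))) (rho (rho z₃)) *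
        kzFund D2 fKZ (rho (rho ε)) (rho (rho ((1 - ε : ℝ) : ℂ))) *
        kzFund D2 fKZ (rho ((1 + ε : ℝ) : ℂ)) (rho (rho ε)) *
        kzFund D2 fKZ (rho z₃) (rho ((1 + ε : ℝ) : ℂ))) *
      (kzFund D1 fKZ (rho ((1 - ε : ℝ) : ℂ)) (rho z₃) *
        kzFund D1 fKZ (rho ε) (rho ((1 - ε : ℝ) : ℂ)) *
        kzFund D1 fKZ ((1 + ε : ℝ) : ℂ) (rho ε) * kzFund D1 fKZ z₃ ((1 + ε : ℝ) : ℂ)) *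
      (kzFund D0 fKZ ((1 - ε : ℝ) : ℂ) z₃ * kzFund D0 fKZ ε ((1 - ε : ℝ) : ℂ)) := by
        simp only [mul_assoc]
    _ = 1 := by rw [hM1, hR, hL, hM2, mul_assoc (kzFund D0 fKZ (rho (rho z₃)) ↑ε), hHub, hfin]

/-- **The loop identity in terms of `seg` and `cap`**:
`σ̂²(cap) σ̂²(seg) σ̂(cap) σ̂(seg) cap seg = 1`. [cite: Drinfeld1991, §2, (2.12)] -/
theorem loop_identity_cap :
    NCSeries.push mrho (NCSeries.push mrho (cap ε)) * NCSeries.push mrho (NCSeries.push mrho (seg ε)) *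
      NCSeries.push mrho (cap ε) * NCSeries.push mrho (seg ε) * cap ε * seg ε = 1 := by
  have hε1 : ε < 1 := by linarith
  have h := loop_identity hε hε2
  rw [cap, ← cB_mul_cA hε hε1, NCSeries.push_mul, NCSeries.push_mul, NCSeries.push_mul,
    NCSeries.push_mul]
  simpa only [mul_assoc] using h

end Loop

end KZHex

end Literature.NumberTheory.Transcendental
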